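import Mathlib
import HarnessLib
import Summits.Langlands.Langlands.Theses.GSpinCensusRung
import Literature.NumberTheory.GaloisRepresentations.HeckeDeterminant

/-!
# Birth skeleton (BC3) for crux stmt-Langlands-11945
`Summit.Langlands.Langlands.Theses.GSpinCensusRung.LimitWeightGaloisRep` — line `birth`

Route `route-Langlands-GSpinCensusRung` (`closes : SingularWeightLifting → MoretBaillySeed →
LimitWeightGaloisRep → BeyondTheRung → Langlands`).  The crux (rank 4, "WEAK (A) FOR THE PROVINCE AT
ALMOST ALL ℓ") says: for `F` totally real and `π` cuspidal on `GL_6(𝔸_F)` of pure Hodge infinity type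
`(3; 0,1,1,2,2,3)` (L-algebraic, NOT regular: two doubled Hodge–Tate weights) whose unramified shadow is
essentially self-dual, there is a finite set `S` of primes such that for every `ℓ ∉ S` and every
`ι : ℚ̄_ℓ ≃ ℂ` some `ρ : Γ_F → GL_6(ℚ̄_ℓ)` has Satake–Frobenius matching with `π` at almost all places
(`SatakeFrobCompatibleAt ι π.1 ρ v`: `ρ` unramified at `v`, `charpoly ρ(Frob_v^arith) = ∏ (X - ι⁻¹(α⁻¹))`,
the L-normalisation `arithFrobPolyOfSatake ι q_v 1 α`).

This file is the skeleton that concludes the crux BY NAME from three named stubs, cut along the three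
inputs of EVERY known construction of Galois representations for non-degenerate limits of discrete
series — Taylor 1991 for `GSp_4` of low weight, Goldring–Koskivirta 2019 Thm. 3.5.1 for Hodge-type
hosts (their proof of case [LDS], §11.1: "the compositions `θ_n ∘ ρ^pseudo` form a 𝔭-adic system of
pseudo-representations; hence their limit gives a `ℚ̄_p`-valued pseudo-representation; by [Taylor 1991]
it is the trace of a true semisimple representation"):

* `stub_rationalSatakeModel` — A NUMBER FIELD OF DEFINITION FOR THE SATAKE POLYNOMIALS
  (L-arithmeticity of `π` with ONE number field `E`, Buzzard–Gee Conj. 3.1.6 for this `π`; for a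
  `∂̄`/coherent-cohomological form it is the rationality of coherent cohomology of the host Shimura
  variety: Harris 1990, Blasius–Harris–Ramakrishnan 1994 — after the transfer of `π` to the inner form
  `GSpin(2,5)` of the route's census, where its archimedean parameter `(3/2,1/2,1/2)` is a NON-DEGENERATE
  limit of discrete series).  Typed: a number field `E`, `emb : E →+* ℂ`, a finite set `T` of places and
  `P : v ↦ P_v ∈ E[X]` with `emb(P_v) = ∏_{a ∈ α_v} (X - a⁻¹)` for the Satake parameter `α_v` of `π`
  at every `v ∉ T` (`IsRationalSatakeModel`).  Size L.
* `stub_torsionShadows` — THE ENGINE (torsion Galois determinants for the limit weight; Goldring–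
  Koskivirta's [Tor] one node over on the Dynkin diagram, over a totally real field): given the rational
  model, outside a finite set `S` of primes `ℓ`, for every `ι` there is a finite `T' ⊇` (bad places) such
  that for EVERY `m` a `6`-dimensional Chenevier determinant `D_m` of `Γ_F` with values in `𝒪/ℓ^m`
  (`𝒪` = closed unit ball of `ℚ̄_ℓ`; tree `GaloisDeterminant`) exists which is locally constant,
  unramified outside `T'` and has Frobenius characteristic polynomial `≡ ι⁻¹ emb (P_v) mod ℓ^m` at every
  `v ∉ T'` (`IsTorsionShadow`).  Intended proof: transfer `GL_6 → SO_7 ↔` inner form `SO(2,5)/GSpin(2,5)`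
  (Arthur 2013; Ishimoto arXiv:2301.12143 for non-quasi-split, non-regular parameters), realisation of
  the eigensystem in coherent `H^i` (`i ∈ {1,2}` per real place) of the Hodge-type Shimura variety of
  (a ℚ-similitude subgroup of) `Res_{F/ℚ} GSpin(V)`, `V/F` of signature `(2,5)` at every real place, at
  `ℓ`-hyperspecial level (`ℓ ∉ S`); Goldring–Koskivirta Thm. 3.4.1 (reduction to `H⁰` by strata Hasse
  invariants, under their assumptions (1)–(2) for a non-PEL host) and Thm. 3.5.1 [Tor] (the Hecke algebra
  of `H^i(Sh_K^tor, V_η^sub ⊗ ℤ/ℓ^m)` receives a determinant, from Condition 2.4.2 (ERG-ℓ): Galois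
  representations for extremely regular discrete series on the host = Arthur/Taïbi transfer to `GL_6` +
  Harris–Lan–Taylor–Thorne/Shin), composed with the eigenvalue character `θ_m` of the reduction of `π`'s
  eigenclass.  Size: open-problem (the hardest stub; it carries every engine risk of the crux's
  why-it-might-fail except the two peeled off into stubs 1 and 3).
* `stub_determinantLimit` — THE ℓ-ADIC LIMIT (Taylor 1991 §1 / Chenevier 2014, pure Galois theory,
  any number field `F`, any dimension `n`): if for every `m` there is such a torsion shadow `D_m` with
  Frobenius data `j(P_v) mod ℓ^m` off `T'`, `P_v ∈ E[X]`, `E` a NUMBER FIELD, `j : E →+* ℚ̄_ℓ`, then a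
  genuine continuous `ρ : Γ_F → GL_n(ℚ̄_ℓ)` unramified off `T'` with `charpoly ρ(Frob_v^arith) = j(P_v)`
  exists.  Proof shape: Chebotarev density + Amitsur/Vaccarino uniqueness ⇒ the `D_m` are compatible;
  their limit is an `O_{ℂ_ℓ}`-valued continuous determinant whose characteristic polynomials lie, by
  density and continuity, in the closure `K₀` of `ℚ_ℓ · j(E)` — a FINITE extension of `ℚ_ℓ` because `E`
  is a number field (this is where stub 1 is used: with transcendental or infinitely generated Frobenius
  data the limit lives over `ℂ_ℓ` and need not descend to `ℚ̄_ℓ`); Chenevier Thm. A over `K̄₀` gives a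
  semisimple `ρ`, continuous and defined over a finite `K₁/K₀` (Taylor 1991 Thm. 1; Baire), embedded in
  `ℚ̄_ℓ` over `K₀`; inertia-invariance of the `D_m` gives unramifiedness of the semisimple `ρ`.  Size L
  (none of Chebotarev, Amitsur's formula, Chenevier's Thm. A is in Mathlib or the tree).

Shape (for `ledger skeleton check` / `#h21_check_skeleton`): §0 names the crux's clauses as `def`s
(VERBATIM copies under the route file's `open`s; `crux_iff` is `Iff.rfl`, which certifies it); each stub
is `theorem stub_<name> (binders) : <conclusion> := by sorry`; `_Goal.stub_<name> : Prop :=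
type_of% @stub_<name>` names that statement; the composition
`LimitWeightGaloisRep_of (h₁ : _Goal.stub_rationalSatakeModel) (h₂ : _Goal.stub_torsionShadows)
(h₃ : _Goal.stub_determinantLimit) : LimitWeightGaloisRep` is proved without `sorry` and concludes the
route decl BY NAME; the last `example` feeds the three stubs to it.

Disproof used: none — the crux directory `Cruxes/LimitWeightGaloisRep/` did not exist before this file
(no `Disproof.lean`), and the negatives index of the summit has no entry on this crux (2026-08-17).
BC3 probes (planner folder `bc/probe_*.lean`): for each stub, `stub → LimitWeightGaloisRep` and
`stub → Langlands` by `first | exact? | simpa | aesop` FAIL (recorded in NOTES.md with rc and goals).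
-/

set_option linter.dupNamespace false

noncomputable section

namespace Summit.Langlands.Langlands.Cruxes.LimitWeightGaloisRep.Birth

open Summit.Langlands.Langlands.Theses.GSpinCensusRung
open scoped BigOperators Topology Manifold Classical MeasureTheory ProbabilityTheory Matrix InnerProductSpace ComplexConjugate ContinuousMap
open Filter Set Function TopologicalSpace MeasureTheory
open Literature.NumberTheory.GaloisRepresentations Literature.NumberTheory.Automorphic Polynomial NumberField IsDedekindDomain Field

/-! ## 0. Named copies of the crux's clauses (verbatim; `crux_iff` below is `Iff.rfl`) -/

section Clauses

variable {F : Type} [Field F] [NumberField F]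

/-- Hypothesis clause of the crux: the UNRAMIFIED SHADOW OF ESSENTIAL SELF-DUALITY of `π` — a `GL_1`
datum `χ` such that at almost every place the Satake parameters `α` of `π` and `β` of `χ` satisfy
`{c · α_i⁻¹} = {α_i}` for some `c ∈ β` (verbatim from the route file). [folklore] -/
def EssSelfDualShadow {hcpt : isCompact_glFiniteIntegralLevel 6 F}
    (π : CuspidalAutomorphicRepData 6 F hcpt) : Prop :=
  ∃ (h₁ : isCompact_glFiniteIntegralLevel 1 F) (χ : CuspidalAutomorphicRepData 1 F h₁),
    ∀ᶠ v : HeightOneSpectrum (𝓞 F) in cofinite, ∃ α β : Multiset ℂ,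
      π.1.HasSatakeParamAt v α ∧ χ.1.HasSatakeParamAt v β ∧ ∃ c ∈ β, α.map (fun z => c * z⁻¹) = α

/-- Conclusion clause of the crux: WEAK (A) AT ALMOST ALL `ℓ` — outside a finite set of primes `ℓ`, for
every `ι : ℚ̄_ℓ ≃ ℂ` some `ρ : Γ_F → GL_6(ℚ̄_ℓ)` has Satake–Frobenius matching with `π` at almost all
places (verbatim from the route file). [folklore] -/
def WeakGaloisAAE {hcpt : isCompact_glFiniteIntegralLevel 6 F}
    (π : CuspidalAutomorphicRepData 6 F hcpt) : Prop :=
  ∃ S : Finset ℕ, ∀ (ℓ : ℕ) [Fact ℓ.Prime], ℓ ∉ S → ∀ (ι : PadicAlgCl ℓ ≃+* ℂ),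
    ∃ ρ : FramedGaloisRep F (PadicAlgCl ℓ) 6,
      ∀ᶠ v : HeightOneSpectrum (𝓞 F) in cofinite, SatakeFrobCompatibleAt ι π.1 ρ v

end Clauses

/-- The crux, clause by clause (definitional unfolding of §0; certifies the copies are verbatim).
[folklore] -/
theorem crux_iff : LimitWeightGaloisRep ↔
    ∀ (F : Type) [Field F] [NumberField F] [IsTotallyReal F]
      (hcpt : isCompact_glFiniteIntegralLevel 6 F) (π : CuspidalAutomorphicRepData 6 F hcpt),
      π.1.HasHodgeInfinityType 3 {0, 1, 1, 2, 2, 3} → EssSelfDualShadow π → WeakGaloisAAE π :=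
  Iff.rfl

/-! ## 1. Rational models of the Satake polynomials (the output of stub 1) -/

section RationalModel

variable {F : Type} [Field F] [NumberField F]

/-- `IsRationalSatakeModel π E emb T P`: **the L-normalised Satake polynomials of `π` off `T` are defined
over the field `E` through `emb : E →+* ℂ`** — at every finite place `v ∉ T`, `π` is unramified with a
Satake parameter `α` (unitary normalisation of the tree) and `emb (P v) = ∏_{a ∈ α} (X - a⁻¹)`, the
complex polynomial whose image under `ι⁻¹` is `arithFrobPolyOfSatake ι q_v 1 α`, the predicted
characteristic polynomial of an ARITHMETIC Frobenius for an L-algebraic `π` (`map_satakePoly`).  For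
`GL_n` the semisimple class `diag(α)` is defined over `E` iff `∏ (X - α_i) ∈ E[X]` iff
`∏ (X - α_i⁻¹) ∈ E[X]`, so with `E` a number field this is Buzzard–Gee's "`π` is L-arithmetic"
(Def. 3.1.5) off the finite set `T`. [cite: BuzzardGeeLMS2014, Def. 3.1.5 and Conj. 3.1.6] -/
def IsRationalSatakeModel {n : ℕ} {hcpt : isCompact_glFiniteIntegralLevel n F}
    (π : AutomorphicRepData (AutomorphyDatum.gl n F hcpt)) (E : Type) [Field E] (emb : E →+* ℂ)
    (T : Finset (HeightOneSpectrum (𝓞 F))) (P : HeightOneSpectrum (𝓞 F) → E[X]) : Prop :=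
  ∀ v ∉ T, ∃ α : Multiset ℂ, π.HasSatakeParamAt v α ∧ (P v).map emb = (α.map fun a ↦ X - C a⁻¹).prod

/-- Transport of the L-normalised Satake polynomial along `ι⁻¹`: `ι⁻¹ (∏ (X - a⁻¹))` is the tree's
`arithFrobPolyOfSatake ι q 1 α` (`arithFrobPolyOfSatake_one`). [cite: BuzzardGeeLMS2014, §2.1] -/
theorem map_satakePoly {ℓ : ℕ} [Fact ℓ.Prime] (ι : PadicAlgCl ℓ ≃+* ℂ) (q : ℕ) (α : Multiset ℂ) :
    ((α.map fun a ↦ X - C a⁻¹).prod).map (ι.symm : ℂ ≃+* PadicAlgCl ℓ).toRingHom =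
      arithFrobPolyOfSatake ι q 1 α := by
  rw [arithFrobPolyOfSatake_one, Polynomial.map_multiset_prod, Multiset.map_map]
  congr 1
  refine Multiset.map_congr rfl fun a _ ↦ ?_
  simp

end RationalModel

/-! ## 2. Torsion shadows: determinants of `Γ_F` with values in `𝒪/ℓ^m` (the output of stub 2) -/

section Torsion

variable (ℓ : ℕ) [Fact ℓ.Prime]

/-- The closed unit ball `𝒪 = {x : |x| ≤ 1}` of `ℚ̄_ℓ = PadicAlgCl ℓ` (valuation ring of the spectral
norm; Mathlib `Valuation.integer` of `PadicAlgCl.valued`). [folklore] -/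
def ballInt : Subring (PadicAlgCl ℓ) :=
  (Valued.v : Valuation (PadicAlgCl ℓ) NNReal).integer

/-- `𝒪 / ℓ^m 𝒪`, the ring of values of the `m`-th torsion shadow (for `m = 0` the zero ring). [folklore] -/
abbrev ModPow (m : ℕ) : Type :=
  ballInt ℓ ⧸ Ideal.span {((ℓ : ballInt ℓ)) ^ m}

/-- Reduction `𝒪 → 𝒪 / ℓ^m`. [folklore] -/
def reduceModPow (m : ℕ) : ballInt ℓ →+* ModPow ℓ m :=
  Ideal.Quotient.mk _

variable {F : Type} [Field F] [NumberField F]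

/-- `IsTorsionShadow ℓ m T' Q D`: the `d`-dimensional Chenevier determinant `D` of `Γ_F` with values in
`𝒪/ℓ^m` (tree `GaloisDeterminant`, Chenevier §1.2 / Scholze Def. V.1.8) is
(i) LOCALLY CONSTANT: its characteristic polynomials `D(1 - X g)` are right-invariant under an open
subgroup of `Γ_F` (for the discrete ring `𝒪/ℓ^m` this is Chenevier's continuity, §2.5, i.e. `D` is
pulled back from a finite quotient `Gal(L/F)`);
(ii) UNRAMIFIED OUTSIDE `T'` (tree `GaloisDeterminant.IsUnramifiedAt`: inertia-coset invariance);
(iii) at every `v ∉ T'` the characteristic polynomial of every arithmetic Frobenius is the reduction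
`mod ℓ^m` of an `𝒪`-integral lift `Q₀` of the target `Q v ∈ ℚ̄_ℓ[X]` (tree
`GaloisDeterminant.HasFrobCharpolyAt`).  This is the shape of Goldring–Koskivirta's conclusion [Tor]
(Thm. 3.5.1) composed with an eigenvalue character `θ_m`, and of Taylor's `𝔭`-adic systems of
pseudo-representations. [cite: GoldringKoskivirta2019, Thm. 3.5.1] [cite: Chenevier2014Determinants, §1.2 and §2.5] -/
def IsTorsionShadow {d : ℕ} (m : ℕ) (T' : Finset (HeightOneSpectrum (𝓞 F)))
    (Q : HeightOneSpectrum (𝓞 F) → (PadicAlgCl ℓ)[X]) (D : GaloisDeterminant F (ModPow ℓ m) d) :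
    Prop :=
  (∃ U : OpenSubgroup (absoluteGaloisGroup F), ∀ g u : absoluteGaloisGroup F, u ∈ U →
      D.revCharpoly (MonoidAlgebra.of (ModPow ℓ m) (absoluteGaloisGroup F) (g * u)) =
        D.revCharpoly (MonoidAlgebra.of (ModPow ℓ m) (absoluteGaloisGroup F) g)) ∧
    ∀ v ∉ T', D.IsUnramifiedAt v ∧ ∃ Q₀ : (ballInt ℓ)[X], Q₀.map (ballInt ℓ).subtype = Q v ∧
      D.HasFrobCharpolyAt v (Q₀.map (reduceModPow ℓ m))

end Torsion

/-! ## 3. The three stubs -/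

/-- **STUB 1 — a number field of definition for the Satake polynomials** (L-arithmeticity with one
`E`).  For `F` totally real and `π` cuspidal on `GL_6(𝔸_F)` of pure Hodge infinity type
`(3; 0,1,1,2,2,3)` with essentially self-dual unramified shadow, there are a NUMBER FIELD `E`, an
embedding `emb : E →+* ℂ`, a finite set `T` of finite places and `P : v ↦ P_v ∈ E[X]` such that off `T`
the L-normalised Satake polynomial `∏ (X - α_i⁻¹)` of `π_v` is `emb (P_v)` (`IsRationalSatakeModel`).
Why plausibly true: `π` is L-algebraic (`IsPureOfHodgeType.isLAlgebraic`), and Buzzard–Gee Conj. 3.1.6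
predicts L-algebraic ⇒ L-arithmetic; for THIS `π` the intended proof is the rational structure on the
coherent cohomology (canonical extensions of automorphic bundles on a toroidal compactification) of the
host Shimura variety in which the transfer of `π` to `GSpin(2,5)` is realised — Harris 1990 (forms of
`∂̄`-cohomology type have `π_f` defined over a number field) and Blasius–Harris–Ramakrishnan 1994
(non-degenerate limits of discrete series occur in coherent cohomology and are Galois-conjugation
stable) — followed by the `E`-rationality of the unramified transfer `SO_7 ↔ GL_6` of Satake parameters.
Why it might fail as a lemma: it needs the same transfer to the inner form as stub 2 (Arthur 2013 +
Ishimoto for the non-quasi-split `SO(2,5)` at a non-regular parameter) and the orthogonal-type `π`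
(where no `GSpin(2,5)` host exists) ride along; without a host, algebraicity of Satake parameters of a
non-regular `π` is open (Clozel / Buzzard–Gee).  Size L.  Leans on: `CuspidalAutomorphicRepData`,
`HasSatakeParamAt`, `HasHodgeInfinityType` (tree).
[cite: Harris1990, Introduction and §3 (rationality of coherent cohomology classes)]
[cite: BlasiusHarrisRamakrishnan1994, Introduction and §§2–4]
[cite: BuzzardGeeLMS2014, Def. 3.1.5 and Conj. 3.1.6] -/
theorem stub_rationalSatakeModel (F : Type) [Field F] [NumberField F] [IsTotallyReal F]
    (hcpt : isCompact_glFiniteIntegralLevel 6 F) (π : CuspidalAutomorphicRepData 6 F hcpt)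
    (hH : π.1.HasHodgeInfinityType 3 {0, 1, 1, 2, 2, 3}) (hsd : EssSelfDualShadow π) :
    ∃ (E : Type) (_ : Field E) (_ : NumberField E) (emb : E →+* ℂ)
      (T : Finset (HeightOneSpectrum (𝓞 F))) (P : HeightOneSpectrum (𝓞 F) → E[X]),
      IsRationalSatakeModel π.1 E emb T P := by
  sorry

/-- **STUB 2 — the engine: torsion Galois determinants in the limit weight** (Goldring–Koskivirta's
[Tor] for the `(3; 0,1,1,2,2,3)` province, one node over on the Dynkin diagram, over a totally real
field; the hardest stub, difficulty open-problem).  For `F`, `π` as in the crux, GIVEN a rational Satake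
model `(E, emb, T, P)` (stub 1's output), there is a finite set `S` of rational primes such that for
every prime `ℓ ∉ S` and every `ι : ℚ̄_ℓ ≃ ℂ` there is a finite set `T'` of places (intended:
`T ∪ {v ∣ ℓ} ∪` ramification of `π` and of the host) such that for EVERY `m : ℕ` a `6`-dimensional
determinant `D_m` of `Γ_F` with values in `𝒪/ℓ^m` exists which is locally constant, unramified outside
`T'`, and whose Frobenius characteristic polynomial at each `v ∉ T'` is `ι⁻¹ emb (P_v) mod ℓ^m`
(`IsTorsionShadow`; in particular `ι⁻¹ emb (P_v)` is `ℓ`-integral there, as it must be: Frobenius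
eigenvalues at `v ∤ ℓ` are `ℓ`-adic units).  It is implied by the crux itself (reduce a stable lattice
of `ρ` modulo `ℓ^m`), so it is a genuinely weaker statement.  Intended proof (route header, layer 2):
symplectic alternative and Arthur's transfer `GL_6 → SO_7`, Ishimoto's multiplicity formula for the
inner form `SO(2,5)` at the generic non-regular parameter `(3/2,1/2,1/2)` (a non-degenerate limit of
discrete series, singular on exactly one non-compact root); realisation of the eigensystem in coherent
`H^i` of the Hodge-type Shimura variety of (a ℚ-similitude subgroup of) `Res_{F/ℚ} GSpin(V)`, `V/F` of
signature `(2,5)` at every real place, at `ℓ`-hyperspecial level, with an `𝒪_E`-integral structure;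
Goldring–Koskivirta Thm. 3.4.1 (reduction to `H⁰` by strata Hasse invariants: the Hecke algebra of
`H^i(Sh^tor, V_η^sub ⊗ ℤ/ℓ^m)` is a quotient of that of `H⁰` in weight `η + a η_ω`) and Thm. 3.5.1
[Tor] (that Hecke algebra receives a determinant with `D(X - Frob_v) =` Hecke polynomial, from
Condition 2.4.2 (ERG-ℓ) = Galois representations for extremely regular discrete series on the host,
here Arthur/Taïbi transfer back to regular algebraic essentially self-dual cuspidal representations of
`GL_6(𝔸_F)` + Harris–Lan–Taylor–Thorne / Shin, tree fact `exists_galoisRep_of_regularAlgebraic`);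
compose with the eigenvalue character `θ_m : 𝕋 → 𝒪_E/𝔭^m → 𝒪/ℓ^m` of the reduction of `π`'s
eigenclass and pull back along `Γ_F → Gal`.  Why it might fail: Goldring–Koskivirta need assumptions
(1)–(2) of Thm. 3.4.1 for a host that is neither PEL nor compact (vanishing of `R^i π_* V^sub` on the
minimal compactification; `S_e = S_e^tor`), stated over `ℚ` (Remark 3.5.4 for `Γ_F` variants), and
Condition (ERG-ℓ) for `(GSpin(2,5)-type host, std)`; the transfer of a NON-REGULAR `π` to the
non-quasi-split inner form with the right archimedean packet member carrying `(𝔭⁻,K)`-cohomology is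
unverified (sign in the multiplicity formula); orthogonal-type `π` with this infinity type have no such
host.  Leans on: `GaloisDeterminant`, `ChenevierDeterminant.revCharpoly`, `.IsUnramifiedAt`,
`.HasFrobCharpolyAt` (tree, `HeckeDeterminant`), `PadicAlgCl`, `Valuation.integer` (Mathlib).
[cite: GoldringKoskivirta2019, Thm. 3.4.1, Cor. 3.4.2 and Thm. 3.5.1 ([Tor]); Condition 2.4.2]
[cite: Taylor1991, §1 and §2 (congruences to Galois-carrying weights for low-weight Siegel forms)]
[cite: PilloniStroh2016, Introduction (Galois representations for higher coherent cohomology, PEL case)]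
[cite: Arthur2013, Thm. 1.5.2] [cite: HarrisLanTaylorThorneRMS2016, Thm. A]
[cite: Scholze2015, Def. V.1.8 and Thm. V.4.1 (Hecke-valued determinants, the GL_n template)] -/
theorem stub_torsionShadows (F : Type) [Field F] [NumberField F] [IsTotallyReal F]
    (hcpt : isCompact_glFiniteIntegralLevel 6 F) (π : CuspidalAutomorphicRepData 6 F hcpt)
    (hH : π.1.HasHodgeInfinityType 3 {0, 1, 1, 2, 2, 3}) (hsd : EssSelfDualShadow π)
    (E : Type) [Field E] [NumberField E] (emb : E →+* ℂ) (T : Finset (HeightOneSpectrum (𝓞 F)))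
    (P : HeightOneSpectrum (𝓞 F) → E[X]) (hP : IsRationalSatakeModel π.1 E emb T P) :
    ∃ S : Finset ℕ, ∀ (ℓ : ℕ) [Fact ℓ.Prime], ℓ ∉ S → ∀ ι : PadicAlgCl ℓ ≃+* ℂ,
      ∃ T' : Finset (HeightOneSpectrum (𝓞 F)), ∀ m : ℕ, ∃ D : GaloisDeterminant F (ModPow ℓ m) 6,
        IsTorsionShadow ℓ m T'
          (fun v ↦ (P v).map ((ι.symm : ℂ ≃+* PadicAlgCl ℓ).toRingHom.comp emb)) D := by
  sorry

/-- **STUB 3 — the ℓ-adic limit of torsion shadows with number-field Frobenius data is a genuine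
representation** (Taylor 1991 §1 / Chenevier 2014; pure Galois theory: any number field `F`, any `n`).
Let `E` be a NUMBER FIELD, `j : E →+* ℚ̄_ℓ`, `T'` a finite set of places of `F` and `P : v ↦ P_v ∈ E[X]`.
If for every `m` some `n`-dimensional determinant `D_m` of `Γ_F` over `𝒪/ℓ^m` is locally constant,
unramified outside `T'` and has Frobenius characteristic polynomials `j(P_v) mod ℓ^m` at every `v ∉ T'`,
then there is a continuous `ρ : Γ_F → GL_n(ℚ̄_ℓ)` unramified outside `T'` whose arithmetic Frobenii at
every `v ∉ T'` have characteristic polynomial `j(P_v)`.  Proof shape: (a) COMPATIBILITY — by Chebotarev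
every element of a finite quotient `Gal(L/F)` through which `D_m` and `D_{m'} mod ℓ^m` both factor is an
arithmetic Frobenius at a prime above some `v ∉ T'`, so their characteristic polynomials agree on the
group, hence (Amitsur's formula / Vaccarino's theorem: a determinant of a group is determined by the
characteristic polynomials of the group elements, Chenevier §1) `D_{m'} ≡ D_m`; (b) LIMIT — the tower
defines a continuous determinant over `lim 𝒪/ℓ^m = 𝒪_{ℂ_ℓ}` (determinants are the points of a
representable functor); (c) DESCENT — its characteristic-polynomial coefficients are continuous on `Γ_F`
and lie in `K₀ :=` closure of `ℚ_ℓ · j(E)` on the dense Frobenius set, and `K₀/ℚ_ℓ` is FINITE since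
`E` is a number field, so by Vaccarino's generators the determinant is `𝒪_{K₀}`-valued (with
transcendental or infinitely generated data the limit would live over `ℂ_ℓ` and could fail to descend —
the reason stub 1 exists); (d) RECONSTRUCTION — Chenevier Thm. A over `K̄₀` (char. 0: equivalently
Taylor's Thm. 1 for the trace pseudocharacter) gives a semisimple `ρ` with `det(X - ρ(g)) = D(X - g)`,
continuous and realisable over a finite `K₁/K₀` (Taylor 1991, Thm. 1 and its corollary; Baire), and
`K₁ ↪ ℚ̄_ℓ` over `K₀`; (e) inertia-invariance of the traces and semisimplicity give `ρ(I_v) = 1` for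
`v ∉ T'`.  Why it might fail as a lemma: only by mis-typing — the statement is the classical limit
argument; in Lean it needs Chebotarev's density theorem, Amitsur's formula and Chenevier's Thm. A, none of
which is in Mathlib or the tree.  Size L.  Leans on: `GaloisDeterminant`, `FramedGaloisRep`,
`IsUnramifiedAt`, `HasFrobCharpolyAt` (tree), `exists_hasQlModel` (tree fact, for (d)).
[cite: Taylor1991, §1, Thm. 1 (pseudo-representations ⇒ representations) and §2 (the 𝔭-adic limit)]
[cite: Chenevier2014Determinants, Thm. A (= Thm. 2.12), §1.1–1.3 (Amitsur's formula, Vaccarino's theorem)]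
[cite: GoldringKoskivirta2019, §11.1, proof of Thm. 3.5.1 case [LDS]] [cite: Rouquier1996, Thm. 5.1] -/
theorem stub_determinantLimit (F : Type) [Field F] [NumberField F] (n : ℕ) (ℓ : ℕ) [Fact ℓ.Prime]
    (E : Type) [Field E] [NumberField E] (j : E →+* PadicAlgCl ℓ)
    (T' : Finset (HeightOneSpectrum (𝓞 F))) (P : HeightOneSpectrum (𝓞 F) → E[X])
    (hD : ∀ m : ℕ, ∃ D : GaloisDeterminant F (ModPow ℓ m) n,
      IsTorsionShadow ℓ m T' (fun v ↦ (P v).map j) D) :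
    ∃ ρ : FramedGaloisRep F (PadicAlgCl ℓ) n,
      ∀ v ∉ T', ρ.IsUnramifiedAt v ∧ ρ.HasFrobCharpolyAt v ((P v).map j) := by
  sorry

/-! ## 4. The stub statements as named `Prop`s (literally the types of the stubs; no `sorry` inherited) -/

namespace _Goal

/-- The statement of `stub_rationalSatakeModel`, as a named `Prop` (literally its type). [folklore] -/
def stub_rationalSatakeModel : Prop :=
  type_of% @Summit.Langlands.Langlands.Cruxes.LimitWeightGaloisRep.Birth.stub_rationalSatakeModel

/-- The statement of `stub_torsionShadows`, as a named `Prop` (literally its type). [folklore] -/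
def stub_torsionShadows : Prop :=
  type_of% @Summit.Langlands.Langlands.Cruxes.LimitWeightGaloisRep.Birth.stub_torsionShadows

/-- The statement of `stub_determinantLimit`, as a named `Prop` (literally its type). [folklore] -/
def stub_determinantLimit : Prop :=
  type_of% @Summit.Langlands.Langlands.Cruxes.LimitWeightGaloisRep.Birth.stub_determinantLimit

end _Goal

/-! ## 5. The composition (kernel-checked, no `sorry`): RATIONAL MODEL → TORSION SHADOWS → LIMIT → crux by name -/

/-- **The crux from the three stubs.**  Given `F`, `π` with the crux hypotheses: STUB 1 gives a number
field `E`, `emb`, a finite `T` and rational Satake polynomials `P_v`; STUB 2 gives the finite set `S` of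
bad primes and, for `ℓ ∉ S` and `ι`, a finite `T'` and torsion shadows `D_m` for all `m` with Frobenius
data `ι⁻¹ emb (P_v) mod ℓ^m`; STUB 3 (with `j = ι⁻¹ ∘ emb`) turns the tower into a genuine
`ρ : Γ_F → GL_6(ℚ̄_ℓ)` unramified off `T'` with `charpoly ρ(Frob_v^arith) = ι⁻¹ emb (P_v)`; off the
finite set `T ∪ T'` this is `arithFrobPolyOfSatake ι q_v 1 α_v` (`map_satakePoly`), i.e.
`SatakeFrobCompatibleAt ι π.1 ρ v` for cofinitely many `v`.  Hypotheses are, by name, the statements of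
the three stubs; the conclusion is the route decl `LimitWeightGaloisRep`. [folklore] -/
theorem LimitWeightGaloisRep_of (h₁ : _Goal.stub_rationalSatakeModel)
    (h₂ : _Goal.stub_torsionShadows) (h₃ : _Goal.stub_determinantLimit) :
    LimitWeightGaloisRep := by
  -- read the three named statements
  have hRat : ∀ (F : Type) [Field F] [NumberField F] [IsTotallyReal F]
      (hcpt : isCompact_glFiniteIntegralLevel 6 F) (π : CuspidalAutomorphicRepData 6 F hcpt),
      π.1.HasHodgeInfinityType 3 {0, 1, 1, 2, 2, 3} → EssSelfDualShadow π →
      ∃ (E : Type) (_ : Field E) (_ : NumberField E) (emb : E →+* ℂ)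
        (T : Finset (HeightOneSpectrum (𝓞 F))) (P : HeightOneSpectrum (𝓞 F) → E[X]),
        IsRationalSatakeModel π.1 E emb T P := h₁
  have hSh : ∀ (F : Type) [Field F] [NumberField F] [IsTotallyReal F]
      (hcpt : isCompact_glFiniteIntegralLevel 6 F) (π : CuspidalAutomorphicRepData 6 F hcpt),
      π.1.HasHodgeInfinityType 3 {0, 1, 1, 2, 2, 3} → EssSelfDualShadow π →
      ∀ (E : Type) [Field E] [NumberField E] (emb : E →+* ℂ) (T : Finset (HeightOneSpectrum (𝓞 F)))
        (P : HeightOneSpectrum (𝓞 F) → E[X]), IsRationalSatakeModel π.1 E emb T P →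
      ∃ S : Finset ℕ, ∀ (ℓ : ℕ) [Fact ℓ.Prime], ℓ ∉ S → ∀ ι : PadicAlgCl ℓ ≃+* ℂ,
        ∃ T' : Finset (HeightOneSpectrum (𝓞 F)), ∀ m : ℕ, ∃ D : GaloisDeterminant F (ModPow ℓ m) 6,
          IsTorsionShadow ℓ m T'
            (fun v ↦ (P v).map ((ι.symm : ℂ ≃+* PadicAlgCl ℓ).toRingHom.comp emb)) D := h₂
  have hLim : ∀ (F : Type) [Field F] [NumberField F] (n : ℕ) (ℓ : ℕ) [Fact ℓ.Prime]
      (E : Type) [Field E] [NumberField E] (j : E →+* PadicAlgCl ℓ)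
      (T' : Finset (HeightOneSpectrum (𝓞 F))) (P : HeightOneSpectrum (𝓞 F) → E[X]),
      (∀ m : ℕ, ∃ D : GaloisDeterminant F (ModPow ℓ m) n,
        IsTorsionShadow ℓ m T' (fun v ↦ (P v).map j) D) →
      ∃ ρ : FramedGaloisRep F (PadicAlgCl ℓ) n,
        ∀ v ∉ T', ρ.IsUnramifiedAt v ∧ ρ.HasFrobCharpolyAt v ((P v).map j) := h₃
  -- the crux, clause by clause
  rw [crux_iff]
  intro F _ _ _ hcpt π hH hsd
  -- STUB 1: a number field of definition for the Satake polynomials off a finite `T`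
  obtain ⟨E, _, _, emb, T, P, hP⟩ := hRat F hcpt π hH hsd
  -- STUB 2: bad primes `S`; for `ℓ ∉ S` and `ι`, a finite `T'` and torsion shadows for every `m`
  obtain ⟨S, hS⟩ := hSh F hcpt π hH hsd E emb T P hP
  refine ⟨S, fun ℓ _ hℓ ι ↦ ?_⟩
  obtain ⟨T', hT'⟩ := hS ℓ hℓ ι
  -- STUB 3: the ℓ-adic limit along `j = ι⁻¹ ∘ emb`
  obtain ⟨ρ, hρ⟩ :=
    hLim F 6 ℓ E ((ι.symm : ℂ ≃+* PadicAlgCl ℓ).toRingHom.comp emb) T' P hT'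
  refine ⟨ρ, ?_⟩
  -- off the finite set `T ∪ T'` the Frobenius polynomial is the predicted one
  filter_upwards [T.eventually_cofinite_notMem, T'.eventually_cofinite_notMem] with v hvT hvT'
  obtain ⟨α, hα, hPv⟩ := hP v hvT
  obtain ⟨hur, hchar⟩ := hρ v hvT'
  refine ⟨α, hα, hur, ?_⟩
  rwa [← Polynomial.map_map, hPv, map_satakePoly ι v.residueCard α] at hchar

/-- By-name sanity check (an `example`, so it is not a declaration of the file): the three stubs feed
the composition as they stand. -/
example : LimitWeightGaloisRep :=
  LimitWeightGaloisRep_of stub_rationalSatakeModel stub_torsionShadows stub_determinantLimit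

end Summit.Langlands.Langlands.Cruxes.LimitWeightGaloisRep.Birth

end
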